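import Summits.KontsevichZagierPeriods.KontsevichZagierPeriods.Theorems.OffTetraSectorKernel.Negative.SliceCore

/-!
# `OffTetraSectorKernel` (stmt-KontsevichZagierPeriods-10557) — negative side: the slice invariant, part 2 (invariance)

Part 2 of 3. Rule (3) over the base `ℝ⁰` changes the slice function by a `ℚ`-semialgebraic function
(`sliceFun_mem_of_nl_zero`: it is `0`, then the semialgebraic primitive minus a constant, then a
constant, the constants being values of the primitive at the semialgebraic endpoints), whence
`closure_add_nl_le_comap_semialgFun`: the subgroup generated by rules (1a), (1b), (3) maps into the
semialgebraic slice classes. Summary of the whole development: module docstring of `SliceWitness.lean`.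
cdisprove (refuter) file; sorry-free; axioms ⊆ {propext, Classical.choice, Quot.sound}.
[Kontsevich–Zagier 2001, §1.2, rules (1)–(3)]
-/


noncomputable section

open MeasureTheory Set Filter


open Literature.NumberTheory.Transcendental Literature.NumberTheory.Transcendental.KZ

namespace Summit.KontsevichZagierPeriods.HyperbolicBloch.OffTetraSectorKernelNegative

open Literature.ModelTheory.ExponentialFields (IsSemialgebraic isSemialgebraic_univ
  isSemialgebraic_empty tarski_seidenberg_real_holds)

/-! ### Rule (3) over the base `ℝ⁰`: the slice function is the (semialgebraic) primitive -/

/-- Lebesgue measure of `ℝ⁰ = {pt}` is `1`. [folklore] -/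
theorem volume_univ_fin_zero' : volume (univ : Set (Fin 0 → ℝ)) = 1 := by
  rw [volume_pi, Measure.pi_univ]
  simp

/-- `Fin.snoc` over the empty tuple is the constant tuple. [folklore] -/
theorem snoc_fin_zero (y : Fin 0 → ℝ) (s : ℝ) : (Fin.snoc y s : Fin (0 + 1) → ℝ) = fun _ => s := by
  funext i
  have hi : i = Fin.last 0 := Fin.ext (by have := i.2; simp only [Fin.val_last]; omega)
  rw [hi, Fin.snoc_last]

/-- A `1`-tuple is the constant tuple of its entry. [folklore] -/
theorem eq_const_fin_one (t : Fin 1 → ℝ) : t = fun _ => t 0 := by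
  funext i
  rw [Subsingleton.elim i 0]

/-- The graph hypothesis of a `ℚ`-semialgebraic function on `ℝ⁰ = univ` says its value is a
`ℚ`-semialgebraic point. [folklore] -/
theorem isSemialgebraic_setOf_eq_of_fin_zero {a : (Fin 0 → ℝ) → ℝ}
    (ha : IsSemialgebraicFunOn ℚ (univ : Set (Fin 0 → ℝ)) a) :
    IsSemialgebraic ℚ {z : Fin 1 → ℝ | z 0 = a default} := by
  unfold IsSemialgebraicFunOn at ha
  convert ha using 1
  ext z
  simp only [mem_setOf_eq, mem_univ, true_and]
  constructor
  · intro hz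
    refine ⟨default, ?_⟩
    rw [snoc_fin_zero, eq_const_fin_one z, hz]
  · rintro ⟨y, rfl⟩
    rw [Subsingleton.elim y default, snoc_fin_zero]

section NLZero

variable (r : IntegralRep (0 + 1)) (r' : IntegralRep 0) (a b : (Fin 0 → ℝ) → ℝ)
  (F : (Fin (0 + 1) → ℝ) → ℝ)

/-- The slice function of a dimension-one Newton–Leibniz instance over the non-empty base:
`0` left of the band, the primitive inside, its total variation to the right. [folklore] -/
theorem sliceFun_nl_zero_apply (huniv : r'.domain = univ)
    (hab : ∀ x ∈ r'.domain, a x ≤ b x)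
    (hdom : r.domain = {z | (Fin.init z : Fin 0 → ℝ) ∈ r'.domain ∧
      a (Fin.init z) ≤ z (Fin.last 0) ∧ z (Fin.last 0) ≤ b (Fin.init z)})
    (hcont : ∀ x ∈ r'.domain, ContinuousOn (fun t : ℝ => F (Fin.snoc x t)) (Icc (a x) (b x)))
    (hderiv : ∀ x ∈ r'.domain, ∀ t ∈ Ioo (a x) (b x),
      HasDerivAt (fun s : ℝ => F (Fin.snoc x s)) (r.integrand (Fin.snoc x t)) t) (x : ℝ) :
    sliceFun (of r - of r') x =
      if x < a default then 0 else F (fun _ => min x (b default)) - F (fun _ => a default) := by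
  set A := a default with hA
  set B := b default with hB
  have hAB : A ≤ B := hab default (by rw [huniv]; trivial)
  have hdom' : r.domain = {z : Fin (0 + 1) → ℝ | A ≤ z 0 ∧ z 0 ≤ B} := by
    rw [hdom]
    ext z
    simp only [mem_setOf_eq, huniv, mem_univ, true_and]
    rw [Subsingleton.elim (Fin.init z) default]
    rfl
  rw [map_sub, Pi.sub_apply, sliceFun_of, sliceFun_of, sliceWindow_zero, inter_empty,
    Measure.restrict_empty, integral_zero_measure, sub_zero, sliceWindow_succ]
  split_ifs with hx
  · have hempty : r.domain ∩ {y : Fin (0 + 1) → ℝ | y 0 ≤ x} = ∅ := by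
      rw [hdom']
      ext z
      simp only [mem_inter_iff, mem_setOf_eq, mem_empty_iff_false, iff_false, not_and, not_le]
      intro hz
      linarith [hz.1]
    rw [hempty, Measure.restrict_empty, integral_zero_measure]
  · push Not at hx
    have hAm : A ≤ min x B := le_min hx hAB
    have hD : r.domain ∩ {y : Fin (0 + 1) → ℝ | y 0 ≤ x} =
        {z | (Fin.init z : Fin 0 → ℝ) ∈ (univ : Set (Fin 0 → ℝ)) ∧
          (fun _ => A) (Fin.init z) ≤ z (Fin.last 0) ∧ z (Fin.last 0) ≤ (fun _ => min x B) (Fin.init z)} := by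
      rw [hdom']
      ext z
      simp only [mem_inter_iff, mem_setOf_eq, mem_univ, true_and, le_min_iff]
      change (A ≤ z 0 ∧ z 0 ≤ B) ∧ z 0 ≤ x ↔ A ≤ z 0 ∧ z 0 ≤ x ∧ z 0 ≤ B
      tauto
    have hcalc := setIntegral_band_eq_of_hasDerivAt (n := 0) (D := r.domain ∩ {y | y 0 ≤ x})
      (τ := univ) (f := r.integrand)
      (g := fun y => F (Fin.snoc y (min x B)) - F (Fin.snoc y A))
      (a := fun _ => A) (b := fun _ => min x B) (F := F) MeasurableSet.univ
      ((IntegralRep.measurableSet_domain_holds r).inter (measurableSet_sliceWindow x (0 + 1)))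
      (r.integrableOn.mono_set inter_subset_left) (fun _ _ => hAm) hD
      (fun y _ => by
        rw [Subsingleton.elim y default]
        exact (hcont default (by rw [huniv]; trivial)).mono (Icc_subset_Icc le_rfl (min_le_right _ _)))
      (fun y _ t ht => by
        rw [Subsingleton.elim y default]
        exact hderiv default (by rw [huniv]; trivial) t ⟨ht.1, lt_of_lt_of_le ht.2 (min_le_right _ _)⟩)
      (fun _ _ => rfl)
    rw [hcalc, Measure.restrict_univ]
    have hconst : (fun y : Fin 0 → ℝ => F (Fin.snoc y (min x B)) - F (Fin.snoc y A)) =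
        fun _ => F (fun _ => min x B) - F (fun _ => A) := by
      funext y
      rw [snoc_fin_zero, snoc_fin_zero]
    rw [hconst, integral_const, measureReal_def, volume_univ_fin_zero']
    simp

/-- **Rule (3) over the base `ℝ⁰` preserves the slice class**: the slice function is
`ℚ`-semialgebraic (it is `0`, then the semialgebraic primitive `F` minus a constant, then a
constant — the constants being values of `F` at the `ℚ`-semialgebraic endpoints). [folklore] -/
theorem sliceFun_mem_of_nl_zero (hF : IsSemialgebraicFunOn ℚ r.domain F)
    (ha : IsSemialgebraicFunOn ℚ r'.domain a) (hb : IsSemialgebraicFunOn ℚ r'.domain b)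
    (hab : ∀ x ∈ r'.domain, a x ≤ b x)
    (hdom : r.domain = {z | (Fin.init z : Fin 0 → ℝ) ∈ r'.domain ∧
      a (Fin.init z) ≤ z (Fin.last 0) ∧ z (Fin.last 0) ≤ b (Fin.init z)})
    (hcont : ∀ x ∈ r'.domain, ContinuousOn (fun t : ℝ => F (Fin.snoc x t)) (Icc (a x) (b x)))
    (hderiv : ∀ x ∈ r'.domain, ∀ t ∈ Ioo (a x) (b x),
      HasDerivAt (fun s : ℝ => F (Fin.snoc x s)) (r.integrand (Fin.snoc x t)) t) :
    sliceFun (of r - of r') ∈ semialgFun := by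
  rcases Set.eq_empty_or_nonempty r'.domain with hempty | hne
  · -- empty base: the band is empty and the slice function vanishes
    have hrd : r.domain = ∅ := by
      rw [hdom, hempty]
      ext z
      simp
    have h0 : sliceFun (of r - of r') = 0 := by
      ext x
      simp [sliceFun_of, hrd, hempty]
    rw [h0]
    exact semialgFun.zero_mem
  -- non-empty base `= univ`
  have huniv : r'.domain = univ := Subsingleton.eq_univ_of_nonempty hne
  set A := a default with hAdef
  set B := b default with hBdef
  have hAB : A ≤ B := hab default (by rw [huniv]; trivial)
  have hApt : IsSemialgebraic ℚ {z : Fin 1 → ℝ | z 0 = A} :=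
    isSemialgebraic_setOf_eq_of_fin_zero (huniv ▸ ha)
  have hBpt : IsSemialgebraic ℚ {z : Fin 1 → ℝ | z 0 = B} :=
    isSemialgebraic_setOf_eq_of_fin_zero (huniv ▸ hb)
  have hdom' : r.domain = {z : Fin 1 → ℝ | A ≤ z 0 ∧ z 0 ≤ B} := by
    rw [hdom]
    ext z
    simp only [mem_setOf_eq, huniv, mem_univ, true_and]
    rw [Subsingleton.elim (Fin.init z) default]
    rfl
  have hS₂ : IsSemialgebraic ℚ {z : Fin 1 → ℝ | A ≤ z 0 ∧ z 0 ≤ B} :=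
    (isSemialgebraic_setOf_ge_of_eq hApt).inter (isSemialgebraic_setOf_le_of_eq hBpt)
  have hAs : (fun _ => A) ∈ r.domain := by
    rw [hdom']; exact ⟨le_rfl, hAB⟩
  have hBs : (fun _ => B) ∈ r.domain := by
    rw [hdom']; exact ⟨hAB, le_rfl⟩
  have hFA : IsSemialgebraic ℚ {z : Fin 1 → ℝ | z 0 = F (fun _ => A)} :=
    isSemialgebraic_setOf_eq_apply hF hApt hAs
  have hFB : IsSemialgebraic ℚ {z : Fin 1 → ℝ | z 0 = F (fun _ => B)} :=
    isSemialgebraic_setOf_eq_apply hF hBpt hBs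
  -- the slice function, pointwise
  have hval := sliceFun_nl_zero_apply r r' a b F huniv hab hdom hcont hderiv
  rw [mem_semialgFun]
  -- three pieces
  have h1 : IsSemialgebraicFunOn ℚ {t : Fin 1 → ℝ | t 0 < A} (fun _ => ((0 : ℕ) : ℝ)) :=
    isSemialgebraicFunOn_natCast (isSemialgebraic_setOf_lt_of_eq hApt) 0
  have h2 : IsSemialgebraicFunOn ℚ {z : Fin 1 → ℝ | A ≤ z 0 ∧ z 0 ≤ B}
      (F - fun _ => F (fun _ => A)) :=
    IsSemialgebraicFunOn.sub_holds (hdom' ▸ hF) (isSemialgebraicFunOn_const_of_eq hS₂ hFA)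
  have h3 : IsSemialgebraicFunOn ℚ {t : Fin 1 → ℝ | B < t 0}
      ((fun _ => F (fun _ => B)) - fun _ => F (fun _ => A)) :=
    IsSemialgebraicFunOn.sub_holds
      (isSemialgebraicFunOn_const_of_eq (isSemialgebraic_setOf_gt_of_eq hBpt) hFB)
      (isSemialgebraicFunOn_const_of_eq (isSemialgebraic_setOf_gt_of_eq hBpt) hFA)
  have h23 := IsSemialgebraicFunOn.union (F := fun t : Fin 1 → ℝ => sliceFun (of r - of r') (t 0))
    h2 h3 (fun t ht => by
      change sliceFun (of r - of r') (t 0) = F t - F (fun _ => A)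
      rw [hval, if_neg (not_lt.mpr ht.1), min_eq_left ht.2, ← eq_const_fin_one t])
    (fun t ht => by
      change sliceFun (of r - of r') (t 0) = F (fun _ => B) - F (fun _ => A)
      have hBt : B < t 0 := ht
      rw [hval, if_neg (not_lt.mpr (hAB.trans hBt.le)), min_eq_right hBt.le])
  have h123 := IsSemialgebraicFunOn.union (F := fun t : Fin 1 → ℝ => sliceFun (of r - of r') (t 0))
    h1 h23 (fun t ht => by
      change sliceFun (of r - of r') (t 0) = ((0 : ℕ) : ℝ)
      have hAt : t 0 < A := ht
      rw [hval, if_pos hAt, Nat.cast_zero])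
    (fun _ _ => rfl)
  convert h123 using 1
  ext t
  simp only [mem_univ, mem_union, mem_setOf_eq, true_iff]
  rcases lt_or_ge (t 0) A with h | h
  · exact Or.inl h
  · rcases le_or_gt (t 0) B with h' | h'
    · exact Or.inr (Or.inl ⟨h, h'⟩)
    · exact Or.inr (Or.inr h')

end NLZero

/-! ### The slice class is an invariant of rules (1a), (1b), (3) -/

/-- **The subgroup generated by the additivity and Newton–Leibniz moves maps into the
semialgebraic slice classes.** [folklore] -/
theorem closure_add_nl_le_comap_semialgFun :
    AddSubgroup.closure (domainAddRel ∪ integrandAddRel ∪ newtonLeibnizRel) ≤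
      semialgFun.comap sliceFun := by
  refine (AddSubgroup.closure_le _).mpr ?_
  rintro c (hc | hc)
  · rw [SetLike.mem_coe, AddSubgroup.mem_comap, sliceFun_eq_zero_of_mem_add hc]
    exact semialgFun.zero_mem
  · obtain ⟨n, r, r', a, b, F, hF, ha, hb, hab, hdom, hcont, hderiv, hr', rfl⟩ := hc
    rw [SetLike.mem_coe, AddSubgroup.mem_comap]
    cases n with
    | zero => exact sliceFun_mem_of_nl_zero r r' a b F hF ha hb hab hdom hcont hderiv
    | succ m =>
      rw [sliceFun_eq_zero_of_nl_succ r r' a b F hab hdom hcont hderiv hr']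
      exact semialgFun.zero_mem



end Summit.KontsevichZagierPeriods.HyperbolicBloch.OffTetraSectorKernelNegative
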